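import Summits.HodgeConjecture.HodgeConjecture.Theses.TropicalKugaSatakeCayley
import Summits.HodgeConjecture.HodgeConjecture.Theorems.TropicalKugaSatakeCayleyKSModelExists
import Literature.Geometry.Kaehler.ComplexTorusHodge
import Mathlib

/-!
# Route `TropicalKugaSatakeCayley`, crux K2 `KontsevichTransferKS` (stmt-HodgeConjecture-18570), line `birth`,
# STUB 2 `stub_noWeightDrop` — part 1: flat Hodge forms have weight zero

A **flat Hodge form** of the skeleton `Cruxes/KontsevichTransferKS/Lines/birth.lean` is a constant complex
`12`-form `ω` on `Λ_ℝ = ℝ⁸_x ⊕ ℝ⁸_y` of type `(6,6)` on EVERY member `ℂ⁸/(ℤ⁸ ⊕ τ(z)ℤ⁸)`,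
`Im z ∈ ksPosCone`, of the rank-7 Kuga–Satake linear family, read through every Kuga–Satake period map
`Φ(x, y) = x + τ(z)y` (`ComplexTorus.IsConstOfType 6 6 (ω ∘ Φ⁻¹)`). This file proves that such a form is
killed by the derivation of the **weight operator `H(x, y) = (x, -y)`** of the cusp
(`ktks_flat_sum_update_weight`: `Σᵢ ω(w₁, …, H wᵢ, …, w₁₂) = 0`), i.e. has `gr^W`-weight zero
infinitesimally — the mechanism of the stub's card, for which two members on the imaginary axis suffice
(no identification of the family with the `Spin(2,5)` tube domain is needed):

* §1 For an alternating form `ω` and a map `J`, invariance of `ω` under the slotwise rotations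
  `cos θ + sin θ J` differentiates at `θ = 0` (`ContinuousMultilinearMap.hasFDerivAt`, `linearDeriv`)
  to `D_J ω := Σᵢ ω(…, J wᵢ, …) = 0`; the operators with `D_A ω = 0` are closed under commutators
  (`ktks_sum_update_eq_zero_of_comm`) and scalars.
* §2 The diagonal members `z_c = (c i, 0, 0, 0, 0)`, `c > 0`: `Im z_c = c δ₀ ∈ ksPosCone`
  (`B_{c δ₀} = c B₁ = c·diag(2,4,4,8,4,8,8,16)` is positive definite), the period map
  `Φ_c(x, y) = x + i c B₁ y` is an explicit real-linear isomorphism with `IsKSPeriodMap z_c Φ_c`, and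
  `Φ_c⁻¹(e^{iθ} Φ_c w) = cos θ w + sin θ J_c w` with `J_c(x, y) = (-c B₁ y, (c B₁)⁻¹ x)`.
* §3 Hence a flat Hodge form has `D_{J_1} ω = D_{J_2} ω = 0`, and `[J_1, J_2] = (3/2) H`, so
  `D_H ω = 0`.

Part 2 (`…KontsevichTransferKSWeightZeroForms`) shows that a form with `D_H ω = 0` and vanishing
tropical `(6,6)`-block is zero; part 3 (`…KontsevichTransferKSNoWeightDrop`) assembles the stub.
Theorems only: no definition, no named fact, no sorry.

## References

* [vanGeemenVerra2003QuaternionicPryms] B. van Geemen, A. Verra, Quaternionic Pryms and Hodge classes,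
  Topology 42 (2003), §6.1, Rem. 6.6.
* [MikhalkinZharkov2014Eigenwave] G. Mikhalkin, I. Zharkov, Tropical eigenwave and intermediate
  Jacobians (2014), §6.1–6.2.
* [LangeBirkenhake1992] H. Lange, Ch. Birkenhake, Complex Abelian Varieties (1992), §1.1, §8.1.
-/

noncomputable section

set_option linter.dupNamespace false

namespace Summit.HodgeConjecture.HodgeConjecture.Theorems

open Literature.AlgebraicGeometry.Tropical Literature.AlgebraicGeometry.Tropical.TropicalTorus
open Literature.Geometry.Kaehler

/-! ### §1 Infinitesimal invariance: derivations of alternating forms -/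

section Derivation

variable {V : Type*} [NormedAddCommGroup V] [NormedSpace ℝ V] {k : ℕ}

/-- **Rotation invariance differentiates to derivation invariance.** If the alternating form `ω` is
invariant under the one-parameter family `w ↦ cos θ • w + sin θ • J w` (slotwise), then the derivation
`D_J ω (w) = Σᵢ ω(w₁, …, J wᵢ, …, w_k)` vanishes (derivative at `θ = 0`; the derivative of a continuous
multilinear map is `ContinuousMultilinearMap.linearDeriv`). [folklore] -/
theorem ktks_sum_update_eq_zero_of_rotation (ω : V [⋀^Fin k]→L[ℝ] ℂ) (J : V → V)
    (h : ∀ (θ : ℝ) (w : Fin k → V), ω (fun i => Real.cos θ • w i + Real.sin θ • J (w i)) = ω w)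
    (w : Fin k → V) : ∑ i, ω (Function.update w i (J (w i))) = 0 := by
  classical
  set g : ℝ → (Fin k → V) := fun θ i => Real.cos θ • w i + Real.sin θ • J (w i) with hg
  have hg0 : g 0 = w := by
    funext i
    simp [hg]
  have hgd : HasDerivAt g (fun i => J (w i)) 0 := by
    rw [hasDerivAt_pi]
    intro i
    have h1 : HasDerivAt (fun θ : ℝ => Real.cos θ • w i) ((-Real.sin 0) • w i) 0 :=
      (Real.hasDerivAt_cos 0).smul_const (w i)
    have h2 : HasDerivAt (fun θ : ℝ => Real.sin θ • J (w i)) ((Real.cos 0) • J (w i)) 0 :=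
      (Real.hasDerivAt_sin 0).smul_const (J (w i))
    have h12 := h1.add h2
    simp only [Real.sin_zero, neg_zero, zero_smul, Real.cos_zero, one_smul, zero_add] at h12
    exact h12
  have hωd : HasFDerivAt (⇑ω.toContinuousMultilinearMap)
      (ω.toContinuousMultilinearMap.linearDeriv (g 0)) (g 0) :=
    ω.toContinuousMultilinearMap.hasFDerivAt (g 0)
  have hcomp : HasDerivAt (⇑ω.toContinuousMultilinearMap ∘ g)
      (ω.toContinuousMultilinearMap.linearDeriv (g 0) (fun i => J (w i))) 0 :=
    hωd.comp_hasDerivAt (0 : ℝ) hgd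
  have hconst : (⇑ω.toContinuousMultilinearMap ∘ g) = fun _ => ω w := by
    funext θ
    simp only [Function.comp_apply, ContinuousAlternatingMap.coe_toContinuousMultilinearMap, hg]
    exact h θ w
  rw [hconst, hg0] at hcomp
  have hzero : HasDerivAt (fun _ : ℝ => ω w) (0 : ℂ) 0 := hasDerivAt_const 0 (ω w)
  have huniq := hcomp.unique hzero
  rw [ContinuousMultilinearMap.linearDeriv_apply] at huniq
  simpa only [ContinuousAlternatingMap.coe_toContinuousMultilinearMap] using huniq

/-- **The derivations killing a form are closed under commutators.** If `D_A ω = 0` and `D_B ω = 0`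
(slotwise sums), then `D_{AB - BA} ω = 0` (the double sums over two distinct slots agree after
exchanging the slots; the diagonal terms give the commutator). `A`, `B` need not be linear. [folklore] -/
theorem ktks_sum_update_eq_zero_of_comm (ω : V [⋀^Fin k]→L[ℝ] ℂ) (A B : V → V)
    (hA : ∀ w : Fin k → V, ∑ i, ω (Function.update w i (A (w i))) = 0)
    (hB : ∀ w : Fin k → V, ∑ i, ω (Function.update w i (B (w i))) = 0)
    (w : Fin k → V) : ∑ i, ω (Function.update w i (A (B (w i)) - B (A (w i)))) = 0 := by
  classical
  -- `F i j` = the `(i, j)` term of `Σ_j D_A ω (w with B in slot j)`, `G` the same with `A ↔ B`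
  set F : Fin k → Fin k → ℂ := fun i j =>
    ω (Function.update (Function.update w j (B (w j))) i
      (A (Function.update w j (B (w j)) i))) with hF
  set G : Fin k → Fin k → ℂ := fun i j =>
    ω (Function.update (Function.update w j (A (w j))) i
      (B (Function.update w j (A (w j)) i))) with hG
  have hF0 : ∑ j, ∑ i, F i j = 0 := Finset.sum_eq_zero fun j _ => hA _
  have hG0 : ∑ j, ∑ i, G i j = 0 := Finset.sum_eq_zero fun j _ => hB _
  -- diagonal terms
  have hFd : ∀ j, F j j = ω (Function.update w j (A (B (w j)))) := by
    intro j
    simp only [hF, Function.update_self, Function.update_idem]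
  have hGd : ∀ j, G j j = ω (Function.update w j (B (A (w j)))) := by
    intro j
    simp only [hG, Function.update_self, Function.update_idem]
  -- off-diagonal terms agree after the exchange of slots
  have hFG : ∀ i j, i ≠ j → F i j = G j i := by
    intro i j hij
    simp only [hF, hG, Function.update_of_ne hij, Function.update_of_ne (Ne.symm hij)]
    rw [Function.update_comm hij]
  -- the commutator, slotwise
  have hdiag : ∀ j, ω (Function.update w j (A (B (w j)) - B (A (w j)))) = F j j - G j j := by
    intro j
    rw [hFd, hGd]
    exact (ω.toContinuousLinearMap w j).map_sub (A (B (w j))) (B (A (w j)))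
  calc ∑ j, ω (Function.update w j (A (B (w j)) - B (A (w j))))
      = ∑ j, (F j j - G j j) := Finset.sum_congr rfl fun j _ => hdiag j
    _ = ∑ j, ∑ i, (F i j - G j i) := by
        refine Finset.sum_congr rfl fun j _ => ?_
        rw [Finset.sum_eq_single j]
        · intro i _ hij
          rw [hFG i j hij, sub_self]
        · intro h; exact absurd (Finset.mem_univ j) h
    _ = ∑ j, ∑ i, F i j - ∑ j, ∑ i, G j i := by
        simp only [Finset.sum_sub_distrib]
    _ = ∑ j, ∑ i, F i j - ∑ j, ∑ i, G i j := by rw [Finset.sum_comm (f := fun j i => G j i)]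
    _ = 0 := by rw [hF0, hG0, sub_zero]

/-- Linearity of the derivation in the operator: `D_{c • H} ω = c • D_H ω` (slotwise), so
`D_{c • H} ω = 0` with `c ≠ 0` gives `D_H ω = 0`. [folklore] -/
theorem ktks_sum_update_eq_zero_of_smul (ω : V [⋀^Fin k]→L[ℝ] ℂ) (H : V → V) {c : ℝ} (hc : c ≠ 0)
    (h : ∀ w : Fin k → V, ∑ i, ω (Function.update w i (c • H (w i))) = 0)
    (w : Fin k → V) : ∑ i, ω (Function.update w i (H (w i))) = 0 := by
  classical
  have h1 : ∑ i, ω (Function.update w i (c • H (w i))) = c • ∑ i, ω (Function.update w i (H (w i))) := by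
    rw [Finset.smul_sum]
    exact Finset.sum_congr rfl fun i _ => ω.map_update_smul w i c (H (w i))
  have h2 := h w
  rw [h1] at h2
  exact (smul_eq_zero.1 h2).resolve_left hc

end Derivation

/-! ### §2 The diagonal members of the family: explicit period maps, rotations, and `J` -/

section Members

/-- The diagonal of the base form `B₁ = ksForm 0 = diag(2,4,4,8,4,8,8,16)`, as real numbers. -/
theorem ktks_ksBase_map_real :
    (ksBase.map (Int.cast : ℤ → ℝ)) = Matrix.diagonal (fun i : Fin 8 => ((![2, 4, 4, 8, 4, 8, 8, 16] : Fin 8 → ℤ) i : ℝ)) := by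
  rw [ksBase, Matrix.diagonal_map (Int.cast_zero)]

/-- The entries of the base diagonal are positive. [folklore] -/
theorem ktks_diag_pos (i : Fin 8) : (0 : ℝ) < ((![2, 4, 4, 8, 4, 8, 8, 16] : Fin 8 → ℤ) i : ℝ) := by
  fin_cases i <;> simp

/-- **The period isomorphism of a diagonal member.** For a nowhere-zero real diagonal `D` the
real-linear map `(x, y) ↦ x + i D y : ℝ⁸ ⊕ ℝ⁸ → ℂ⁸` is an isomorphism with inverse
`v ↦ (Re v, D⁻¹ Im v)`. [cite: LangeBirkenhake1992, §8.1] -/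
theorem ktks_exists_diagPeriodMap (D : Fin 8 → ℝ) (hD : ∀ i, D i ≠ 0) :
    ∃ Φ : (Fin 8 ⊕ Fin 8 → ℝ) ≃L[ℝ] (Fin 8 → ℂ),
      (∀ w i, Φ w i = (w (Sum.inl i) : ℂ) + (D i : ℂ) * Complex.I * (w (Sum.inr i) : ℂ)) ∧
      (∀ v, Φ.symm v = Sum.elim (fun i => (v i).re) (fun i => (v i).im / D i)) := by
  let e : (Fin 8 ⊕ Fin 8 → ℝ) ≃ₗ[ℝ] (Fin 8 → ℂ) :=
  { toFun := fun w i => (w (Sum.inl i) : ℂ) + (D i : ℂ) * Complex.I * (w (Sum.inr i) : ℂ)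
    map_add' := fun w w' => by
      funext i
      simp only [Pi.add_apply, Complex.ofReal_add]
      ring
    map_smul' := fun c w => by
      funext i
      simp only [Pi.smul_apply, smul_eq_mul, Complex.ofReal_mul, RingHom.id_apply,
        Complex.real_smul]
      ring
    invFun := fun v => Sum.elim (fun i => (v i).re) (fun i => (v i).im / D i)
    left_inv := fun w => by
      funext s
      rcases s with i | i
      · simp
      · simp [hD i]
    right_inv := fun v => by
      funext i
      have hDi := hD i
      apply Complex.ext
      · simp
      · simp
        field_simp }
  exact ⟨e.toContinuousLinearEquiv, fun w i => rfl, fun v => rfl⟩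

/-- **Rotation by `e^{iθ}` in the coordinates of a diagonal member**:
`Φ⁻¹(e^{iθ} Φ w) = cos θ • w + sin θ • J w` with `J(x, y) = (-D y, D⁻¹ x)` (the complex structure
of `ℂ⁸/(ℤ⁸ ⊕ iDℤ⁸)` on `ℝ⁸ ⊕ ℝ⁸`). [cite: LangeBirkenhake1992, §1.1] -/
theorem ktks_symm_exp_smul (D : Fin 8 → ℝ) (hD : ∀ i, D i ≠ 0)
    (Φ : (Fin 8 ⊕ Fin 8 → ℝ) ≃L[ℝ] (Fin 8 → ℂ))
    (hΦ : ∀ w i, Φ w i = (w (Sum.inl i) : ℂ) + (D i : ℂ) * Complex.I * (w (Sum.inr i) : ℂ))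
    (hΦs : ∀ v, Φ.symm v = Sum.elim (fun i => (v i).re) (fun i => (v i).im / D i))
    (θ : ℝ) (w : Fin 8 ⊕ Fin 8 → ℝ) :
    Φ.symm (Complex.exp (θ * Complex.I) • Φ w) =
      Real.cos θ • w + Real.sin θ •
        (Sum.elim (fun i => -(D i * w (Sum.inr i))) (fun i => w (Sum.inl i) / D i)) := by
  rw [hΦs]
  have hexp : Complex.exp (θ * Complex.I) = (Real.cos θ : ℂ) + (Real.sin θ : ℂ) * Complex.I := by
    rw [Complex.exp_mul_I, Complex.ofReal_cos, Complex.ofReal_sin]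
  funext s
  rcases s with i | i
  · simp only [Sum.elim_inl, Pi.smul_apply, hΦ, hexp, Pi.add_apply, smul_eq_mul]
    simp only [Complex.add_re, Complex.mul_re, Complex.mul_im, Complex.ofReal_re, Complex.ofReal_im,
      Complex.I_re, Complex.I_im, Complex.add_im]
    ring
  · have hDi := hD i
    simp only [Sum.elim_inr, Pi.smul_apply, hΦ, hexp, Pi.add_apply, smul_eq_mul]
    simp only [Complex.add_re, Complex.mul_re, Complex.mul_im, Complex.ofReal_re, Complex.ofReal_im,
      Complex.I_re, Complex.I_im, Complex.add_im]
    field_simp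
    ring

/-- The imaginary-axis parameter `z_c = (c·i, 0, 0, 0, 0)` of the tube domain: its imaginary part is
`c • δ₀`. [folklore] -/
theorem ktks_im_axisParam (c : ℝ) :
    (fun k : Fin 5 => ((fun k : Fin 5 => if k = 0 then (c : ℂ) * Complex.I else 0) k).im) =
      fun k => if k = 0 then c else 0 := by
  funext k
  by_cases hk : k = 0 <;> simp [hk]

/-- The real form of the family at `c • δ₀` is the diagonal `c • B₁`. [folklore] -/
theorem ktks_ksMatrix_axis (c : ℝ) :
    ksMatrix (fun k : Fin 5 => if k = 0 then c else 0) =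
      Matrix.diagonal (fun i : Fin 8 => c * ((![2, 4, 4, 8, 4, 8, 8, 16] : Fin 8 → ℤ) i : ℝ)) := by
  rw [ksMatrix]
  have h : ∀ k : Fin 5, (if k = 0 then c else 0) • (ksForm k).map (Int.cast : ℤ → ℝ) =
      if k = 0 then c • (ksForm k).map (Int.cast : ℤ → ℝ) else 0 := by
    intro k
    split_ifs <;> simp
  simp_rw [h]
  rw [Finset.sum_ite_eq' Finset.univ (0 : Fin 5), if_pos (Finset.mem_univ _)]
  rw [show ksForm 0 = ksBase from rfl, ktks_ksBase_map_real]
  ext i j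
  simp only [Matrix.smul_apply, Matrix.diagonal_apply, smul_eq_mul]
  split_ifs <;> simp

/-- For `c > 0` the parameter `z_c = (c·i, 0, 0, 0, 0)` lies in the tube domain: `Im z_c ∈ ksPosCone`
(`B_{c δ₀} = c B₁` is a positive diagonal matrix). [folklore] -/
theorem ktks_axisParam_mem_ksPosCone {c : ℝ} (hc : 0 < c) :
    (fun k : Fin 5 => ((fun k : Fin 5 => if k = 0 then (c : ℂ) * Complex.I else 0) k).im) ∈ ksPosCone := by
  rw [ktks_im_axisParam, ksPosCone, Set.mem_setOf_eq, ktks_ksMatrix_axis]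
  rw [Matrix.posDef_diagonal_iff]
  intro i
  exact mul_pos hc (ktks_diag_pos i)

/-- The period matrix at `z_c` is `c i B₁`: entrywise `τ(z_c)ᵢⱼ = δᵢⱼ · c i dᵢ`. [folklore] -/
theorem ktks_ksPeriod_axis (c : ℝ) (i j : Fin 8) :
    ksPeriod (fun k : Fin 5 => if k = 0 then (c : ℂ) * Complex.I else 0) i j =
      if i = j then (c : ℂ) * Complex.I * (((![2, 4, 4, 8, 4, 8, 8, 16] : Fin 8 → ℤ) i : ℝ) : ℂ) else 0 := by
  rw [ksPeriod_apply]
  have h2 : ∀ k : Fin 5, (if k = 0 then (c : ℂ) * Complex.I else 0) * ((ksForm k i j : ℤ) : ℂ) =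
      if k = 0 then (c : ℂ) * Complex.I * ((ksForm k i j : ℤ) : ℂ) else 0 := by
    intro k
    split_ifs <;> simp
  simp_rw [h2]
  rw [Finset.sum_ite_eq' Finset.univ (0 : Fin 5), if_pos (Finset.mem_univ _)]
  rw [show ksForm 0 = ksBase from rfl]
  have h3 : ((ksBase i j : ℤ) : ℂ) = if i = j then (((![2, 4, 4, 8, 4, 8, 8, 16] : Fin 8 → ℤ) i : ℝ) : ℂ) else 0 := by
    rw [ksBase, Matrix.diagonal_apply]
    split_ifs <;> simp
  rw [h3]
  split_ifs <;> simp

/-- **The diagonal member `z_c` has the period map `(x, y) ↦ x + i c B₁ y`** (`IsKSPeriodMap`).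
[cite: LangeBirkenhake1992, §8.1] -/
theorem ktks_isKSPeriodMap_axis (c : ℝ) (Φ : (Fin 8 ⊕ Fin 8 → ℝ) ≃L[ℝ] (Fin 8 → ℂ))
    (hΦ : ∀ w i, Φ w i = (w (Sum.inl i) : ℂ) +
      ((c * (((![2, 4, 4, 8, 4, 8, 8, 16] : Fin 8 → ℤ) i : ℝ)) : ℝ) : ℂ) * Complex.I * (w (Sum.inr i) : ℂ)) :
    IsKSPeriodMap (fun k : Fin 5 => if k = 0 then (c : ℂ) * Complex.I else 0) Φ := by
  intro x
  funext i
  rw [hΦ]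
  simp_rw [ktks_ksPeriod_axis c, ite_mul, zero_mul]
  rw [Finset.sum_ite_eq Finset.univ i, if_pos (Finset.mem_univ _)]
  push_cast
  ring

end Members

/-! ### §3 Flat Hodge forms are killed by the weight derivation `D_H`, `H(x, y) = (x, -y)` -/

section Weight

/-- **A flat Hodge form is killed by the derivation of the complex structure of every diagonal member
`z_c = (c·i, 0, 0, 0, 0)`, `c > 0`**: `J_c(x, y) = (-c B₁ y, (c B₁)⁻¹ x)`. (Flatness at `z_c` along
the period map `(x, y) ↦ x + i c B₁ y` is invariance of `ω` under the rotations
`cos θ + sin θ J_c`; differentiate at `θ = 0`.) [cite: LangeBirkenhake1992, §1.1 and §8.1] -/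
theorem ktks_flat_sum_update_axis (ω : (Fin 8 ⊕ Fin 8 → ℝ) [⋀^Fin (2 * 6)]→L[ℝ] ℂ)
    (hflat : ∀ z : Fin 5 → ℂ, (fun i => (z i).im) ∈ ksPosCone →
      ∀ Φ : (Fin 8 ⊕ Fin 8 → ℝ) ≃L[ℝ] (Fin 8 → ℂ), IsKSPeriodMap z Φ →
        ComplexTorus.IsConstOfType 6 6
          (ω.compContinuousLinearMap (Φ.symm : (Fin 8 → ℂ) →L[ℝ] (Fin 8 ⊕ Fin 8 → ℝ))))
    {c : ℝ} (hc : 0 < c) (w : Fin (2 * 6) → (Fin 8 ⊕ Fin 8 → ℝ)) :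
    ∑ i, ω (Function.update w i ((fun x : Fin 8 ⊕ Fin 8 → ℝ => Sum.elim (fun j => -((c * ((![2, 4, 4, 8, 4, 8, 8, 16] : Fin 8 → ℤ) j : ℝ)) * x (Sum.inr j))) (fun j => x (Sum.inl j) / (c * ((![2, 4, 4, 8, 4, 8, 8, 16] : Fin 8 → ℤ) j : ℝ)))) (w i))) = 0 := by
  have hD : ∀ j : Fin 8, c * ((![2, 4, 4, 8, 4, 8, 8, 16] : Fin 8 → ℤ) j : ℝ) ≠ 0 := fun j => (mul_pos hc (ktks_diag_pos j)).ne'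
  obtain ⟨Φ, hΦ, hΦs⟩ := ktks_exists_diagPeriodMap (fun j => c * ((![2, 4, 4, 8, 4, 8, 8, 16] : Fin 8 → ℤ) j : ℝ)) hD
  have hKS : IsKSPeriodMap (fun k : Fin 5 => if k = 0 then (c : ℂ) * Complex.I else 0) Φ :=
    ktks_isKSPeriodMap_axis c Φ hΦ
  have hconst := hflat _ (ktks_axisParam_mem_ksPosCone hc) Φ hKS
  refine ktks_sum_update_eq_zero_of_rotation ω
    (fun x : Fin 8 ⊕ Fin 8 → ℝ => Sum.elim (fun j => -((c * ((![2, 4, 4, 8, 4, 8, 8, 16] : Fin 8 → ℤ) j : ℝ)) * x (Sum.inr j))) (fun j => x (Sum.inl j) / (c * ((![2, 4, 4, 8, 4, 8, 8, 16] : Fin 8 → ℤ) j : ℝ))))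
    (fun θ w' => ?_) w
  have h2 := hconst.2 θ (fun i => Φ (w' i))
  simp only [ContinuousAlternatingMap.compContinuousLinearMap_apply, Function.comp_def,
    ContinuousLinearEquiv.coe_coe, ContinuousLinearEquiv.symm_apply_apply, sub_self,
    Int.cast_zero, zero_mul, Complex.exp_zero, one_mul] at h2
  have h3 : (fun i => Φ.symm (Complex.exp (θ * Complex.I) • Φ (w' i))) =
      fun i => Real.cos θ • w' i + Real.sin θ • (fun x : Fin 8 ⊕ Fin 8 → ℝ => Sum.elim (fun j => -((c * ((![2, 4, 4, 8, 4, 8, 8, 16] : Fin 8 → ℤ) j : ℝ)) * x (Sum.inr j))) (fun j => x (Sum.inl j) / (c * ((![2, 4, 4, 8, 4, 8, 8, 16] : Fin 8 → ℤ) j : ℝ)))) (w' i) := by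
    funext i
    exact ktks_symm_exp_smul (fun j => c * ((![2, 4, 4, 8, 4, 8, 8, 16] : Fin 8 → ℤ) j : ℝ)) hD Φ hΦ hΦs θ (w' i)
  rw [h3] at h2
  exact h2

/-- The commutator of the complex structures of the members `z_1` and `z_2` is `3/2` times the
**weight operator `H(x, y) = (x, -y)`** of the cusp (the grading of `ℝ⁸_x ⊕ ℝ⁸_y`). [folklore] -/
theorem ktks_comm_axis_one_two (x : Fin 8 ⊕ Fin 8 → ℝ) :
    (fun x : Fin 8 ⊕ Fin 8 → ℝ => Sum.elim (fun j => -(((1 : ℝ) * ((![2, 4, 4, 8, 4, 8, 8, 16] : Fin 8 → ℤ) j : ℝ)) * x (Sum.inr j))) (fun j => x (Sum.inl j) / ((1 : ℝ) * ((![2, 4, 4, 8, 4, 8, 8, 16] : Fin 8 → ℤ) j : ℝ)))) ((fun x : Fin 8 ⊕ Fin 8 → ℝ => Sum.elim (fun j => -(((2 : ℝ) * ((![2, 4, 4, 8, 4, 8, 8, 16] : Fin 8 → ℤ) j : ℝ)) * x (Sum.inr j))) (fun j => x (Sum.inl j) / ((2 : ℝ) * ((![2, 4, 4, 8, 4, 8,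 8, 16] : Fin 8 → ℤ) j : ℝ)))) x) - (fun x : Fin 8 ⊕ Fin 8 → ℝ => Sum.elim (fun j => -(((2 : ℝ) * ((![2, 4, 4, 8, 4, 8, 8, 16] : Fin 8 → ℤ) j : ℝ)) * x (Sum.inr j))) (fun j => x (Sum.inl j) / ((2 : ℝ) * ((![2, 4, 4, 8, 4, 8, 8, 16] : Fin 8 → ℤ) j : ℝ)))) ((fun x : Fin 8 ⊕ Fin 8 → ℝ => Sum.elim (fun j => -(((1 : ℝ) * ((![2, 4, 4, 8, 4, 8, 8, 16] : Fin 8 → ℤ) j : ℝ)) * x (Sum.inr j))) (fun j => x (Sum.inl j) / ((1 : ℝ) * ((![2, 4, 4, 8, 4, 8, 8, 16] : Fin 8 → ℤ) j : ℝ)))) x) =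
      (3 / 2 : ℝ) • (fun x : Fin 8 ⊕ Fin 8 → ℝ => Sum.elim (fun j => x (Sum.inl j)) (fun j => -x (Sum.inr j))) x := by
  funext s
  rcases s with j | j
  · have hj : ((![2, 4, 4, 8, 4, 8, 8, 16] : Fin 8 → ℤ) j : ℝ) ≠ 0 := (ktks_diag_pos j).ne'
    simp only [Pi.sub_apply, Sum.elim_inl, Sum.elim_inr, Pi.smul_apply, smul_eq_mul]
    field_simp
    ring
  · have hj : ((![2, 4, 4, 8, 4, 8, 8, 16] : Fin 8 → ℤ) j : ℝ) ≠ 0 := (ktks_diag_pos j).ne'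
    simp only [Pi.sub_apply, Sum.elim_inl, Sum.elim_inr, Pi.smul_apply, smul_eq_mul]
    field_simp
    ring

/-- **Flat Hodge forms have weight zero infinitesimally**: `D_H ω = 0` for the weight operator
`H(x, y) = (x, -y)`, since `H = (2/3)·[J_1, J_2]` lies in the Lie algebra generated by the complex
structures of the family. [cite: vanGeemenVerra2003QuaternionicPryms, §6.1] -/
theorem ktks_flat_sum_update_weight (ω : (Fin 8 ⊕ Fin 8 → ℝ) [⋀^Fin (2 * 6)]→L[ℝ] ℂ)
    (hflat : ∀ z : Fin 5 → ℂ, (fun i => (z i).im) ∈ ksPosCone →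
      ∀ Φ : (Fin 8 ⊕ Fin 8 → ℝ) ≃L[ℝ] (Fin 8 → ℂ), IsKSPeriodMap z Φ →
        ComplexTorus.IsConstOfType 6 6
          (ω.compContinuousLinearMap (Φ.symm : (Fin 8 → ℂ) →L[ℝ] (Fin 8 ⊕ Fin 8 → ℝ))))
    (w : Fin (2 * 6) → (Fin 8 ⊕ Fin 8 → ℝ)) :
    ∑ i, ω (Function.update w i ((fun x : Fin 8 ⊕ Fin 8 → ℝ => Sum.elim (fun j => x (Sum.inl j)) (fun j => -x (Sum.inr j))) (w i))) = 0 := by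
  have hA := ktks_flat_sum_update_axis ω hflat one_pos
  have hB := ktks_flat_sum_update_axis ω hflat two_pos
  have hcomm := ktks_sum_update_eq_zero_of_comm ω
    (fun x : Fin 8 ⊕ Fin 8 → ℝ => Sum.elim (fun j => -(((1 : ℝ) * ((![2, 4, 4, 8, 4, 8, 8, 16] : Fin 8 → ℤ) j : ℝ)) * x (Sum.inr j))) (fun j => x (Sum.inl j) / ((1 : ℝ) * ((![2, 4, 4, 8, 4, 8, 8, 16] : Fin 8 → ℤ) j : ℝ))))
    (fun x : Fin 8 ⊕ Fin 8 → ℝ => Sum.elim (fun j => -(((2 : ℝ) * ((![2, 4, 4, 8, 4, 8, 8, 16] : Fin 8 → ℤ) j : ℝ)) * x (Sum.inr j))) (fun j => x (Sum.inl j) / ((2 : ℝ) * ((![2, 4, 4, 8, 4, 8, 8, 16] : Fin 8 → ℤ) j : ℝ))))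
    hA hB
  refine ktks_sum_update_eq_zero_of_smul ω
    (fun x : Fin 8 ⊕ Fin 8 → ℝ => Sum.elim (fun j => x (Sum.inl j)) (fun j => -x (Sum.inr j)))
    (c := (3 / 2 : ℝ)) (by norm_num) (fun w' => ?_) w
  have h := hcomm w'
  have h' : ∀ i, Function.update w' i ((3 / 2 : ℝ) • (fun x : Fin 8 ⊕ Fin 8 → ℝ => Sum.elim (fun j => x (Sum.inl j)) (fun j => -x (Sum.inr j))) (w' i)) =
      Function.update w' i ((fun x : Fin 8 ⊕ Fin 8 → ℝ => Sum.elim (fun j => -(((1 : ℝ) * ((![2, 4, 4, 8, 4, 8, 8, 16] : Fin 8 → ℤ) j : ℝ)) * x (Sum.inr j))) (fun j => x (Sum.inl j) / ((1 : ℝ) * ((![2, 4, 4, 8, 4, 8, 8, 16] : Fin 8 → ℤ) j : ℝ)))) ((fun x : Fin 8 ⊕ Fin 8 → ℝ => Sum.elim (fun j => -(((2 : ℝ) * ((![2, 4, 4, 8, 4, 8, 8, 16] : Fin 8 → ℤ) j : ℝ)) * x (Sum.inr j))) (fun j => x (Sum.inl j) / ((2 : ℝ) * ((![2, 4, 4,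 8, 4, 8, 8, 16] : Fin 8 → ℤ) j : ℝ)))) (w' i)) - (fun x : Fin 8 ⊕ Fin 8 → ℝ => Sum.elim (fun j => -(((2 : ℝ) * ((![2, 4, 4, 8, 4, 8, 8, 16] : Fin 8 → ℤ) j : ℝ)) * x (Sum.inr j))) (fun j => x (Sum.inl j) / ((2 : ℝ) * ((![2, 4, 4, 8, 4, 8, 8, 16] : Fin 8 → ℤ) j : ℝ)))) ((fun x : Fin 8 ⊕ Fin 8 → ℝ => Sum.elim (fun j => -(((1 : ℝ) * ((![2, 4, 4, 8, 4, 8, 8, 16] : Fin 8 → ℤ) j : ℝ)) * x (Sum.inr j))) (fun j => x (Sum.inl j) / ((1 : ℝ) * ((![2, 4, 4, 8, 4, 8, 8, 16] : Fin 8 → ℤ) j : ℝ)))) (w' i))) := by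
    intro i
    rw [ktks_comm_axis_one_two]
  simp_rw [h']
  exact h

end Weight

end Summit.HodgeConjecture.HodgeConjecture.Theorems

end
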